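import Summits.QuantumFields.YangMills.Theorems.BalabanUVNodesN11TransportBlockCombGauge

/-!
# DAG node N11 — THE SIZE OF THE BLOCK-COMB GAUGE: `L^d − 1` bonds per block, `|Y|·(L^d − 1)` for the forest of `Y`

HEADER — WORK-UNIT METADATA.  Cell `pub-ymgap`, YM-PLAN Track A (HUMAN RULING D-0062), R134 fan-out seat `pub-ymgap-dag-n11-e` (g28) on node N11 [B14]; route
`BalabanUVNodes`, key K1⁹ `StabilityBRunRowsAtRecordR13SepCoPHV` = stmt-QuantumFields-27364 (helper, `--kind proof --supports 27364 --as helper`, count-neutral).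
Companion of this seat's g28 files `…N11TreeGaugeRooted` (p663927) and `…N11TransportBlockCombGauge` (p664969; the block comb `combBonds (L·y) (L·y + L − 1)` of `B(y)`,
`blockOf_ends_of_mem_blockComb`, `castSite_blockLo_add`, `blockBox_nonwrapping`), over gen 15's `treeOrder_combBonds` (injective targets), `castSite_injOn_box`,
`mem_combBonds` and `TorusGeometry` (`Site.blockEquiv`, `Site.card_block`, `Site.blockOf_blockSite`) BY NAME.  Kept apart from p664969 only by the 400-line rule for
Theorems files.

WHY.  p664969 reads def-T's one-step transport (†) on the REDUCED carrier `Free T_Y → SU(N)` (the bonds off the block combs of `Y`).  For the chart seats the size of that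
carrier matters: this file counts the gauge — the comb of a block is a spanning tree of its `L^d` sites.

WHAT THIS FILE PROVES (3 theorems, 0 `def`, 0 `sorry`, standard axioms): `image_tgt_blockComb` (the targets of the comb bonds of `B(y)` are exactly the sites of `B(y)`
other than its corner `blockSite y 0`: every other site `L·y + r`, `r ≠ 0`, is the target of the comb bond in the FIRST direction `μ` with `r_μ ≠ 0`) · ★ `card_blockComb`
(`#comb(B(y)) = L^d − 1`) · ★ `card_blockCombs` (`#T_Y = |Y|·(L^d − 1)`: combs of distinct blocks are disjoint).

HONEST FRAMING.  [folklore] lattice combinatorics; helper lane of K1⁹, count-neutral; nothing of Bałaban's asserted; (B4) ∕ (O3′) NOT closed; N11 NOT discharged; K1⁹ NOT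
closed; counts unmoved (typed 28∕28 · discharged 5∕27).  One finite four-torus programme at fixed `ε = L^{−K}`; R4 closes only the conditional finite-𝕋⁴ rung
`BalabanLadder.UV` — NOT ℝ⁴, NOT OS, NOT a mass gap, NOT Clay.  No `sorry`, `axiom`, `def`, `instance`, `notation`.
-/

open Function Finset

namespace Summit.QuantumFields.YangMills.Theorems.BalabanUVNodesN11BlockCombCard

open Literature.MathematicalPhysics.QuantumFieldTheory.Balaban1983to89
open T4AxialGaugeFixing (TreeOrder combBonds mem_combBonds treeOrder_combBonds)
open T4AxialGaugeSmallField (castSite castSite_apply castSite_add_e castSite_injOn_box)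
open B7Prop1Explicit (e e_apply)
open B8Lemma1NonAbelian (lowPart lowPart_apply e_nonneg)
open BalabanUVNodesN11TransportBlockCombGauge (castSite_blockLo_add blockBox_nonwrapping blockOf_ends_of_mem_blockComb)

variable {P : Params} {j : ℕ}

/-- The targets of the comb bonds of `B(y)` are exactly the sites of `B(y)` other than its corner `blockSite y 0` (= `castSite (L·y)`). [folklore] -/
theorem image_tgt_blockComb (hj : j + 1 ≤ P.m + P.K) (y : Site P (j + 1)) :
    (combBonds (fun κ => (((y κ).val * P.L : ℕ) : ℤ)) (fun κ => (((y κ).val * P.L + (P.L - 1) : ℕ) : ℤ))).image PBond.tgt =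
      (block y).erase (Site.blockSite y fun _ => ⟨0, P.L_pos⟩) := by
  classical
  have hL := P.hL.2
  have hN := blockBox_nonwrapping hj y
  have h0 : (castSite (fun κ => (((y κ).val * P.L : ℕ) : ℤ)) : Site P j) = Site.blockSite y fun _ => ⟨0, P.L_pos⟩ := by
    rw [← castSite_blockLo_add]; simp
  ext z
  simp only [Finset.mem_image, Finset.mem_erase, block, Finset.mem_filter, Finset.mem_univ, true_and]
  constructor
  · rintro ⟨b, hb, rfl⟩
    obtain ⟨x, hlo, hhi, hsrc, -⟩ := mem_combBonds.1 hb
    have hlo' : (fun κ => (((y κ).val * P.L : ℕ) : ℤ)) ≤ x + e b.dir := hlo.trans (le_add_of_nonneg_right (e_nonneg _))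
    refine ⟨?_, (blockOf_ends_of_mem_blockComb hj y hb).2⟩
    rw [PBond.tgt, hsrc, ← castSite_add_e, ← h0]
    intro h
    have h1 := congr_fun (castSite_injOn_box hN hlo' hhi le_rfl
      (fun κ => by simp only; push_cast; omega) h) b.dir
    have h2 := hlo b.dir
    simp only [Pi.add_apply, e_apply, if_true] at h1 h2
    omega
  · rintro ⟨hz0, hz⟩
    -- `z = blockSite y r`, `r ≠ 0`
    obtain ⟨r, rfl⟩ : ∃ r : Fin P.d → Fin P.L, z = Site.blockSite y r :=
      ⟨Site.blockEquiv hj y ⟨z, hz⟩, by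
        have := (Site.blockEquiv hj y).symm_apply_apply ⟨z, hz⟩
        exact (congrArg Subtype.val this).symm⟩
    have hr : ∃ κ, ((r κ : Fin P.L) : ℕ) ≠ 0 := by
      by_contra h
      push Not at h
      exact hz0 (by rw [show r = fun _ => ⟨0, P.L_pos⟩ from funext fun κ => Fin.ext (h κ)])
    -- the first direction in which `r` is nonzero
    obtain ⟨μ, hμ, hmin⟩ : ∃ μ, ((r μ : Fin P.L) : ℕ) ≠ 0 ∧ ∀ κ, κ < μ → ((r κ : Fin P.L) : ℕ) = 0 := by
      obtain ⟨κ₀, hκ₀⟩ := hr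
      have hne : (Finset.univ.filter fun κ => ((r κ : Fin P.L) : ℕ) ≠ 0).Nonempty := ⟨κ₀, by simpa using hκ₀⟩
      refine ⟨(Finset.univ.filter fun κ => ((r κ : Fin P.L) : ℕ) ≠ 0).min' hne, ?_, fun κ hκ => ?_⟩
      · have := Finset.min'_mem _ hne; simpa using this
      · by_contra hrκ
        exact absurd hκ (not_lt.2 (Finset.min'_le _ _ (by simpa using hrκ)))
    -- the comb bond `⟨castSite (L·y + r − e_μ), μ⟩`
    let x : Fin P.d → ℤ := fun κ => (((y κ).val * P.L + r κ : ℕ) : ℤ) - if κ = μ then 1 else 0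
    have hxe : x + e μ = fun κ => (((y κ).val * P.L + r κ : ℕ) : ℤ) := by
      funext κ; simp only [x, Pi.add_apply, e_apply]; split_ifs <;> ring
    refine ⟨⟨castSite x, μ⟩, mem_combBonds.2 ⟨x, ?_, ?_, rfl, ?_⟩, ?_⟩
    · intro κ
      simp only [x]
      split_ifs with h
      · subst h; push_cast; omega
      · push_cast; omega
    · rw [hxe]; intro κ; have := (r κ).isLt; simp only; push_cast; omega
    · funext κ
      simp only [lowPart_apply, x, Pi.sub_apply, Pi.zero_apply]
      split_ifs with h1 h2
      · exact absurd h1 (h2 ▸ lt_irrefl _)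
      · have := hmin κ h1; push_cast; omega
      · rfl
    · rw [PBond.tgt, ← castSite_add_e, hxe, castSite_blockLo_add]

/-- ★ **THE COMB OF A BLOCK HAS `L^d − 1` BONDS** (a spanning tree of the `L^d` sites of `B(y)`): the block-comb gauge removes `L^d − 1` bond variables per block.
[folklore] -/
theorem card_blockComb (hj : j + 1 ≤ P.m + P.K) (y : Site P (j + 1)) :
    (combBonds (fun κ => (((y κ).val * P.L : ℕ) : ℤ)) (fun κ => (((y κ).val * P.L + (P.L - 1) : ℕ) : ℤ)) :
      Finset (PBond P j)).card = P.L ^ P.d - 1 := by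
  classical
  have hT := treeOrder_combBonds (j := j) (blockBox_nonwrapping hj y)
  rw [← Finset.card_image_of_injOn (f := PBond.tgt) (fun b hb b' hb' h => hT.inj b hb b' hb' h), image_tgt_blockComb hj y,
    Finset.card_erase_of_mem, Site.card_block hj]
  exact Finset.mem_filter.2 ⟨Finset.mem_univ _, Site.blockOf_blockSite hj y _⟩

/-- ★ **THE BLOCK-COMB FOREST OF `Y` HAS `|Y|·(L^d − 1)` BONDS**: the combs of distinct blocks are disjoint (their bonds start in different blocks). [folklore] -/
theorem card_blockCombs [DecidableEq (PBond P j)] (hj : j + 1 ≤ P.m + P.K) (Y : Finset (Site P (j + 1))) :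
    (Y.biUnion fun y => (combBonds (fun κ => (((y κ).val * P.L : ℕ) : ℤ)) (fun κ => (((y κ).val * P.L + (P.L - 1) : ℕ) : ℤ)) :
      Finset (PBond P j))).card = Y.card * (P.L ^ P.d - 1) := by
  rw [Finset.card_biUnion, Finset.sum_const_nat fun y _ => card_blockComb hj y]
  intro y _ y' _ hyy'
  refine Finset.disjoint_left.2 fun b hb hb' => hyy' ?_
  rw [← (blockOf_ends_of_mem_blockComb hj y hb).1, (blockOf_ends_of_mem_blockComb hj y' hb').1]

end Summit.QuantumFields.YangMills.Theorems.BalabanUVNodesN11BlockCombCard
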